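import Summits.HodgeConjecture.HodgeConjecture.Theorems.Ring2BindersAbelianSchemeVHCPrimitiveStep
import Summits.HodgeConjecture.HodgeConjecture.Theorems.Ring2BindersAbelianSchemeVHCMiddleDegree
import Literature.AlgebraicGeometry.HodgeTheory.HodgeGenericQbarDescentFiniteMonodromyInputs
import HarnessLib

/-!
# Ring 2 — binder seat b02 (Hodge ladder stage 3): row b02 `AbelianSchemeVHC` IS the variational Hodge conjecture for
# fibrewise LEFSCHETZ-PRIMITIVE classes of codimension `2 ≤ p ≤ n/2` on abelian schemes of EVEN relative dimension `n ≥ 4`,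
# modulo the print residual only

HONEST FRAMING: research route conditional on HC_CM; not a corollary; Q11.4-sentence-2 already refuted in dim ≥ 3.

Cell `pub-hodge-ring2`, binder seat `ring2-b02`, row b02 of `BINDER-OWNERS.md` (`Ring2.Hypotheses.AbelianSchemeVHC`,
`Theorems/Ring2Hypotheses.lean`; OPEN, print-equivalent to `HC_AV`, nothing to discharge). `HC_CM`
(`Theses.RankFourFaces.CMAbelianHodge`) does not occur below; nothing here is a case of the Hodge conjecture; no `sorry`, no
definition, no NEW Literature fact, no node; «10 · 0» untouched.

WHAT THIS PART SETTLES — the variational analogue of AbelianAll parts XIV/XV (`HC_AV_iff_forall_mem_primitiveClasses`,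
`HC_AV_iff_forall_even_mem_primitiveClasses`: `HC_AV` is the Hodge conjecture for Lefschetz-primitive deep-middle classes on
even-dimensional abelian varieties). The halving part sent row b02 to its lower half, the middle-degree part to the diagonal cells
`(2q, q)`; neither touched the LEFSCHETZ DECOMPOSITION inside a degree. With the global first Lefschetz step of
`Ring2BindersAbelianSchemeVHCPrimitiveStep.lean` (the hard-Lefschetz preimages of a global class along the shadow part's global
polarising class `K` are the restrictions of ONE global class — Deligne 1968 on quasi-projective carriers, a tree theorem — and
algebraicity descends to them fibrewise by Lieberman's `A(𝒳_s, K|)`):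

* §1 **`AbelianSchemeVHCPrimitive`** (file-local notation: the body of `Ring2.Hypotheses.AbelianSchemeVHC` with a global class `K`
  polarising every fibre, the binders `2 ≤ p`, `2p ≤ n`, and `W|_{𝒳_s} ∈ P^{2p}(𝒳_s, K|_{𝒳_s})` — fibrewise Lefschetz-PRIMITIVE —
  inserted) and its EVEN-relative-dimension forms `AbelianSchemeVHCPrimitiveEven`, `AbelianSchemeVHCPrimitiveEvenFrom[g]`
  (`Even n`, `g ≤ n`); restrictions from row b02 (forget the extra binders).
* §2 **`map_fiberι_mem_algebraicClasses_of_abelianSchemeVHCPrimitiveEvenFrom`** — the even primitive form from relative dimension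
  `g` on gives the conclusion of row b02 on EVERY carrier of relative dimension `n ≥ g` with quasi-projective total space over a
  smooth irreducible quasi-projective base, in every codimension, FACT-FREE: above the middle the lower shadow; at `2q = n` the
  primitive reduction of the step part on `f` itself; below the middle pad by a constant abelian variety `B` of dimension
  `n - 2q` (`exists_abelianVariety_dim_eq_succ`) — the middle lift `W♯` on `𝒳 × B ⟶ S` (`exists_middleLift`: even relative
  dimension `2(n - q)`, same algebraicity locus, total space quasi-projective by Segre) — and run the primitive reduction THERE.
  Hence `oneParameterAbelianSchemeVHCGerm_of_upTo_of_primitiveEvenFrom` (a dimension slice `n ≤ g` plus the even primitive form from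
  `g + 1` on give the germ form), FACT-FREE.
* §3 **THE BINDER**: `AbelianSchemeVHC ⟺ AbelianSchemeVHCPrimitive ⟺ AbelianSchemeVHCPrimitiveEven ⟺ AbelianSchemeVHCPrimitiveEvenFrom[4]`
  modulo N97 / c20 (`raynaud1970_abelianScheme_section_projective`, used in `←` only); `⟺ AbelianSchemeVHCPrimitiveEvenFrom[g+1]`
  granted `HCUpToDim g`, so `⟺ AbelianSchemeVHCPrimitiveEvenFrom[6]` modulo {c20, c9 Moonen–Zarhin, c28 Markman}; and
  `HC_AV ⟺ AbelianSchemeVHCPrimitiveEvenFrom[4]` modulo {c11, c12, c20}, no `HC_CM`. FIRST CELL WITH CONTENT: families of abelian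
  FOURFOLDS, `p = 2`, classes `W` with `W|_{𝒳_s} ∈ P⁴(𝒳_s) = ker (L_{K|} : H⁴ → H⁶)` at every `s`.

What is NOT claimed: any case of `AbelianSchemeVHC` or of HC; anything about `HC_CM`; the residual (N97 / c20 and the class
targets c9, c11, c12, c28 are HYPOTHESES wherever used, never asserted); a reduction to primitive classes of the MIDDLE degree only
(the middle lift `pr^*(Kʳ ∪ W)` of a primitive class is not primitive; a Clebsch–Gordan lift along `sl₂ ⊗ sl₂` is not attempted).
Row b02 stays OPEN ≡ `HC_AV` modulo print.

References: [Grothendieck1966] footnote 13; [CharlesSchnell2014Notes] Conj. 11.3.1, Prop. 11.3.5, Cor. 11.3.6, Prop. 11.3.11;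
[VoisinHodgeI2002] Def. 6.24, Thm. 6.25, Cor. 6.26, Rem. 6.27, §7.1.2, Thm. 11.30; [VoisinHodgeII2003] Lemma 4.17, Thm. 4.18,
Prop. 9.20; [Deligne1968] Prop. (2.1); [KerrPearlstein2011] §3.1; [BrosnanFangNiePearlstein2009] §6 Lemma 48; [Lieberman1968]
main theorem; [GortzWedhorn2023] Thm. 27.291; [LaurentSchroer2023] Prop. 4.3; [Raynaud1970] XI 1.4 (not held, acq-09263);
[MoonenZarhin1999LowDim] Thms. 0.1–0.2; [Markman2025SecantWeil] Cor. 1.6.1 (unrefereed); [Andre1996Motifs] §6.3;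
[Hartshorne1977] II Ex. 4.9; [SilvermanAEC2009] III.3.6.
-/

-- every declaration of this problem lives in `Summit.HodgeConjecture.HodgeConjecture.…` (summit = sub-problem);
-- namespace `…Ring2.Binders` = the binder seats of the cell's Hodge-ladder stage 3 (`BINDER-OWNERS.md`)
set_option linter.dupNamespace false

noncomputable section

open CategoryTheory CategoryTheory.Limits AlgebraicGeometry Topology MonoidalCategory CartesianMonoidalCategory
open Literature.AlgebraicGeometry Literature.AlgebraicGeometry.Motives
open Literature.AlgebraicGeometry.HodgeTheory
open Literature.AlgebraicGeometry.Andre1996 (andre1996_cmAnchoredPencil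
  andre1996_cmHodgeClasses_algebraicallyAnchoredPencils)

namespace Summit.HodgeConjecture.HodgeConjecture.Ring2.Binders

open Summit.HodgeConjecture.HodgeConjecture.Ring2.Hypotheses
open Summit.HodgeConjecture.HodgeConjecture.Ring2.ClassTargets

variable {𝒳 S : SchemeOver ℂ}

/-! ## §1 The graded statements (file-local notations; nothing is defined or asserted) -/

/-- Row b02 restricted to FIBREWISE LEFSCHETZ-PRIMITIVE classes of codimension `2 ≤ p ≤ n/2` (file-local notation; symbol for
symbol the body of `Ring2.Hypotheses.AbelianSchemeVHC` with a global class `K` polarising every fibre and the binders `2 ≤ p`,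
`2 * p ≤ n`, `W| ∈ primitiveClasses (K|) n (2p)` inserted). -/
local notation3 (prettyPrint := false) "AbelianSchemeVHCPrimitive" =>
  ∀ ⦃n : ℕ⦄ ⦃𝒳 S : SchemeOver ℂ⦄ (f : 𝒳 ⟶ S), IsSmoothProjectiveFamily f n → IrreducibleSpace S.left →
    AlgebraicGeometry.Smooth S.hom →
    (∀ s : ComplexPoints S, ∃ A' : AbelianVariety ℂ, A'.dim = n ∧ Nonempty (A'.X ≅ fiberOver f s)) →
    ∀ (K : complexBetti 𝒳 2),
      (∀ s : ComplexPoints S, IsPolarizationClass n (fiberOver f s) (complexBetti.map (fiberι f s) 2 K)) →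
    ∀ (p : ℕ), 2 ≤ p → 2 * p ≤ n → ∀ (W : complexBetti 𝒳 (2 * p)),
      (∀ s : ComplexPoints S, IsRationalClass (complexBetti.map (fiberι f s) (2 * p) W) ∧
        IsOfHodgeType n (fiberOver f s) (2 * p) p p (complexBetti.map (fiberι f s) (2 * p) W)) →
      (∀ s : ComplexPoints S, complexBetti.map (fiberι f s) (2 * p) W ∈
        primitiveClasses (complexBetti.map (fiberι f s) 2 K) n (2 * p)) →
      (∃ s₀ : ComplexPoints S,
        complexBetti.map (fiberι f s₀) (2 * p) W ∈ algebraicClasses (fiberOver f s₀) p) →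
      ∀ s : ComplexPoints S, complexBetti.map (fiberι f s) (2 * p) W ∈ algebraicClasses (fiberOver f s) p

/-- The same on families of EVEN relative dimension (file-local notation; the binder `Even n` inserted). -/
local notation3 (prettyPrint := false) "AbelianSchemeVHCPrimitiveEven" =>
  ∀ ⦃n : ℕ⦄ ⦃𝒳 S : SchemeOver ℂ⦄ (f : 𝒳 ⟶ S), IsSmoothProjectiveFamily f n → Even n → IrreducibleSpace S.left →
    AlgebraicGeometry.Smooth S.hom →
    (∀ s : ComplexPoints S, ∃ A' : AbelianVariety ℂ, A'.dim = n ∧ Nonempty (A'.X ≅ fiberOver f s)) →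
    ∀ (K : complexBetti 𝒳 2),
      (∀ s : ComplexPoints S, IsPolarizationClass n (fiberOver f s) (complexBetti.map (fiberι f s) 2 K)) →
    ∀ (p : ℕ), 2 ≤ p → 2 * p ≤ n → ∀ (W : complexBetti 𝒳 (2 * p)),
      (∀ s : ComplexPoints S, IsRationalClass (complexBetti.map (fiberι f s) (2 * p) W) ∧
        IsOfHodgeType n (fiberOver f s) (2 * p) p p (complexBetti.map (fiberι f s) (2 * p) W)) →
      (∀ s : ComplexPoints S, complexBetti.map (fiberι f s) (2 * p) W ∈
        primitiveClasses (complexBetti.map (fiberι f s) 2 K) n (2 * p)) →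
      (∃ s₀ : ComplexPoints S,
        complexBetti.map (fiberι f s₀) (2 * p) W ∈ algebraicClasses (fiberOver f s₀) p) →
      ∀ s : ComplexPoints S, complexBetti.map (fiberι f s) (2 * p) W ∈ algebraicClasses (fiberOver f s) p

/-- The same on families of even relative dimension `n ≥ g` (file-local notation; binders `g ≤ n`, `Even n`). -/
local notation3 (prettyPrint := false) "AbelianSchemeVHCPrimitiveEvenFrom[" g "]" =>
  ∀ ⦃n : ℕ⦄ ⦃𝒳 S : SchemeOver ℂ⦄ (f : 𝒳 ⟶ S), IsSmoothProjectiveFamily f n → g ≤ n → Even n → IrreducibleSpace S.left →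
    AlgebraicGeometry.Smooth S.hom →
    (∀ s : ComplexPoints S, ∃ A' : AbelianVariety ℂ, A'.dim = n ∧ Nonempty (A'.X ≅ fiberOver f s)) →
    ∀ (K : complexBetti 𝒳 2),
      (∀ s : ComplexPoints S, IsPolarizationClass n (fiberOver f s) (complexBetti.map (fiberι f s) 2 K)) →
    ∀ (p : ℕ), 2 ≤ p → 2 * p ≤ n → ∀ (W : complexBetti 𝒳 (2 * p)),
      (∀ s : ComplexPoints S, IsRationalClass (complexBetti.map (fiberι f s) (2 * p) W) ∧
        IsOfHodgeType n (fiberOver f s) (2 * p) p p (complexBetti.map (fiberι f s) (2 * p) W)) →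
      (∀ s : ComplexPoints S, complexBetti.map (fiberι f s) (2 * p) W ∈
        primitiveClasses (complexBetti.map (fiberι f s) 2 K) n (2 * p)) →
      (∃ s₀ : ComplexPoints S,
        complexBetti.map (fiberι f s₀) (2 * p) W ∈ algebraicClasses (fiberOver f s₀) p) →
      ∀ s : ComplexPoints S, complexBetti.map (fiberι f s) (2 * p) W ∈ algebraicClasses (fiberOver f s) p

/-- Row b02 restricted to relative dimension `n ≤ g` (file-local notation; verbatim the notation of the rungs part, so that its
lemmas `abelianSchemeVHC_upTo_three`, `abelianSchemeVHC_upTo_of_hcUpToDim` are consumed by name). -/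
local notation3 (prettyPrint := false) "AbelianSchemeVHCUpTo[" g "]" =>
  ∀ ⦃n : ℕ⦄ ⦃𝒳 S : SchemeOver ℂ⦄ (f : 𝒳 ⟶ S), IsSmoothProjectiveFamily f n → n ≤ g → IrreducibleSpace S.left →
    AlgebraicGeometry.Smooth S.hom →
    (∀ s : ComplexPoints S, ∃ A' : AbelianVariety ℂ, A'.dim = n ∧ Nonempty (A'.X ≅ fiberOver f s)) →
    ∀ (p : ℕ) (W : complexBetti 𝒳 (2 * p)),
      (∀ s : ComplexPoints S, IsRationalClass (complexBetti.map (fiberι f s) (2 * p) W) ∧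
        IsOfHodgeType n (fiberOver f s) (2 * p) p p (complexBetti.map (fiberι f s) (2 * p) W)) →
      (∃ s₀ : ComplexPoints S,
        complexBetti.map (fiberι f s₀) (2 * p) W ∈ algebraicClasses (fiberOver f s₀) p) →
      ∀ s : ComplexPoints S, complexBetti.map (fiberι f s) (2 * p) W ∈ algebraicClasses (fiberOver f s) p

/-- Restriction: row b02 gives its fibrewise-primitive form (forget `K`, the bounds and primitivity). [folklore] -/
theorem abelianSchemeVHCPrimitive_of_abelianSchemeVHC (h : AbelianSchemeVHC) : AbelianSchemeVHCPrimitive := by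
  intro n 𝒳 S f hf hirr hsm habel K _ p _ _ W hW _ h₀ s
  exact h f hf hirr hsm habel p W hW h₀ s

/-- Restriction: the fibrewise-primitive form gives its even-relative-dimension form (forget `Even n`). [folklore] -/
theorem abelianSchemeVHCPrimitiveEven_of_abelianSchemeVHCPrimitive (h : AbelianSchemeVHCPrimitive) :
    AbelianSchemeVHCPrimitiveEven := by
  intro n 𝒳 S f hf _ hirr hsm habel K hK p h2 hpn W hW hP h₀ s
  exact h f hf hirr hsm habel K hK p h2 hpn W hW hP h₀ s

/-- Restriction: the even form gives its slice from relative dimension `g` on (forget `g ≤ n`). [folklore] -/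
theorem abelianSchemeVHCPrimitiveEvenFrom_of_abelianSchemeVHCPrimitiveEven (g : ℕ) (h : AbelianSchemeVHCPrimitiveEven) :
    AbelianSchemeVHCPrimitiveEvenFrom[g] := by
  intro n 𝒳 S f hf _ hev hirr hsm habel K hK p h2 hpn W hW hP h₀ s
  exact h f hf hev hirr hsm habel K hK p h2 hpn W hW hP h₀ s

/-- Restriction: row b02 gives its even fibrewise-primitive form from any relative dimension `g` on. [folklore] -/
theorem abelianSchemeVHCPrimitiveEvenFrom_of_abelianSchemeVHC (g : ℕ) (h : AbelianSchemeVHC) :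
    AbelianSchemeVHCPrimitiveEvenFrom[g] :=
  abelianSchemeVHCPrimitiveEvenFrom_of_abelianSchemeVHCPrimitiveEven g
    (abelianSchemeVHCPrimitiveEven_of_abelianSchemeVHCPrimitive (abelianSchemeVHCPrimitive_of_abelianSchemeVHC h))

/-! ## §2 The even primitive form gives row b02 on every quasi-projective carrier, fact-free (padding to even relative dimension) -/

/-- **The even fibrewise-primitive form of row b02 from relative dimension `g` on gives the conclusion of row b02 on every
carrier of relative dimension `n ≥ g` with quasi-projective total space over a smooth irreducible quasi-projective base, in
EVERY codimension — FACT-FREE.** Above the middle: the lower shadow (`map_fiberι_mem_algebraicClasses_of_lowerHalf`). At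
`2q = n`: `n` is even and the step part's `map_fiberι_mem_algebraicClasses_of_forall_mem_primitiveClasses` runs on `f` with the
shadow part's global polarising class. At `2q < n`: pad by an abelian variety `B` of dimension `n - 2q`
(`exists_abelianVariety_dim_eq_succ`); `𝒳 × B ⟶ S` has even relative dimension `2(n - q) ≥ n`, abelian fibres, quasi-projective
total space (Segre, `isQuasiProjectiveOver_tensorObj_of_field`), and the middle lift `W♯` of `W` has the same algebraicity locus
(`exists_middleLift`); run the primitive reduction on the padded carrier. [cite: VoisinHodgeI2002, Thm. 6.25, Cor. 6.26, Rem. 6.27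
and §7.1.2] [cite: VoisinHodgeII2003, Thm. 4.18] [cite: KerrPearlstein2011, §3.1] [cite: BrosnanFangNiePearlstein2009, §6 Lemma 48]
[cite: Lieberman1968, main theorem] [cite: Hartshorne1977, II Ex. 4.9] -/
theorem map_fiberι_mem_algebraicClasses_of_abelianSchemeVHCPrimitiveEvenFrom {g : ℕ}
    (h : AbelianSchemeVHCPrimitiveEvenFrom[g]) (f : 𝒳 ⟶ S) {n : ℕ} (hf : IsSmoothProjectiveFamily f n) (hgn : g ≤ n)
    (h𝒳 : IsQuasiProjectiveOver 𝒳) (hS : IsQuasiProjectiveOver S) [IrreducibleSpace S.left]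
    (hSs : AlgebraicGeometry.Smooth S.hom)
    (hA : ∀ s : ComplexPoints S, ∃ A' : AbelianVariety ℂ, A'.dim = n ∧ Nonempty (A'.X ≅ fiberOver f s))
    (p : ℕ) (W : complexBetti 𝒳 (2 * p))
    (hW : ∀ s : ComplexPoints S, IsRationalClass (complexBetti.map (fiberι f s) (2 * p) W) ∧
      IsOfHodgeType n (fiberOver f s) (2 * p) p p (complexBetti.map (fiberι f s) (2 * p) W))
    {s₀ : ComplexPoints S} (h₀ : complexBetti.map (fiberι f s₀) (2 * p) W ∈ algebraicClasses (fiberOver f s₀) p)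
    (s : ComplexPoints S) : complexBetti.map (fiberι f s) (2 * p) W ∈ algebraicClasses (fiberOver f s) p := by
  haveI : IsSeparated S.hom := hS.isSeparated
  refine map_fiberι_mem_algebraicClasses_of_lowerHalf f hf h𝒳 hS hSs hA Set.univ (fun q hq W' hW' h₀' t _ ↦ ?_)
    p W hW h₀ s (Set.mem_univ s)
  rcases Nat.eq_or_lt_of_le hq with hqn | hqn
  · -- `2q = n`: even relative dimension; the primitive reduction on `f` itself
    obtain ⟨K, hK⟩ := exists_forall_isPolarizationClass_map_fiberι f hf h𝒳
    exact map_fiberι_mem_algebraicClasses_of_forall_mem_primitiveClasses f hf h𝒳 hS hSs hA K hK Set.univ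
      (fun q' h2 hq' W'' hW'' hP h₀'' u _ ↦ h f hf hgn ⟨q, by omega⟩ ‹_› hSs hA K hK q' h2 hq' W'' hW'' hP ⟨s₀, h₀''⟩ u)
      q W' hW' h₀' t (Set.mem_univ t)
  · -- `2q < n`: pad by an abelian variety of dimension `n - 2q ≥ 1`, lift `W'` to the middle of `𝒳 × B ⟶ S`, reduce there
    obtain ⟨B, hB⟩ := exists_abelianVariety_dim_eq_succ ℂ (n - 2 * q - 1)
    have hqB : 2 * q + B.dim = n := by omega
    obtain ⟨hf', hA', W'', hW'', hiff⟩ := exists_middleLift f hf h𝒳 hA B hqB W' hW'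
    have h𝒳' : IsQuasiProjectiveOver (𝒳 ⊗ B.X) := isQuasiProjectiveOver_tensorObj_of_field h𝒳
      (IsQuasiProjectiveOver.of_isProjectiveOver (AbelianVariety.isSmoothProjective_holds (A := B)).isProjectiveOver)
    obtain ⟨K, hK⟩ := exists_forall_isPolarizationClass_map_fiberι (fst 𝒳 B.X ≫ f) hf' h𝒳'
    exact (hiff t).1 (map_fiberι_mem_algebraicClasses_of_forall_mem_primitiveClasses (fst 𝒳 B.X ≫ f) hf' h𝒳' hS hSs hA'
      K hK Set.univ (fun q' h2 hq' W₃ hW₃ hP h₀₃ u _ ↦ h _ hf' (by omega) ⟨n - q, by omega⟩ ‹_› hSs hA' K hK q' h2 hq' W₃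
        hW₃ hP ⟨s₀, h₀₃⟩ u) (q + B.dim) W'' hW'' ((hiff s₀).2 h₀') t (Set.mem_univ t))

/-- **GLUING, fact-free: a dimension slice `n ≤ g` and the even fibrewise-primitive form from `n ≥ g + 1` on give the germ form
`OneParameterAbelianSchemeVHCGerm`** (its carriers have quasi-projective total space over an affine, hence quasi-projective,
curve; the open set is all of `S(ℂ)`). [cite: CharlesSchnell2014Notes, Conj. 11.3.1] [cite: KerrPearlstein2011, §3.1]
[cite: Lieberman1968, main theorem] -/
theorem oneParameterAbelianSchemeVHCGerm_of_upTo_of_primitiveEvenFrom {g : ℕ} (h₁ : AbelianSchemeVHCUpTo[g])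
    (h₂ : AbelianSchemeVHCPrimitiveEvenFrom[g + 1]) : OneParameterAbelianSchemeVHCGerm := by
  intro n 𝒳 S f hf h𝒳 hirr haff hsm _ habel _ p W hW s₀ hs₀
  haveI := hirr
  haveI := haff
  haveI := hsm
  haveI : LocallyOfFiniteType S.hom := inferInstance
  refine ⟨Set.univ, isOpen_univ, Set.mem_univ _, fun s _ ↦ ?_⟩
  rcases Nat.lt_or_ge g n with hgn | hng
  · exact map_fiberι_mem_algebraicClasses_of_abelianSchemeVHCPrimitiveEvenFrom h₂ f hf (by omega) h𝒳
      (IsQuasiProjectiveOver.of_isAffine S) hsm habel p W hW hs₀ s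
  · exact h₁ f hf hng hirr hsm habel p W hW ⟨s₀, hs₀⟩ s

/-- **The even fibrewise-primitive form gives the germ form — FACT-FREE** (the slices `n ≤ 3` are the rungs' unconditional
`abelianSchemeVHC_upTo_three`). [cite: CharlesSchnell2014Notes, Conj. 11.3.1] [cite: VoisinHodgeII2003, §10.2.3 proof of Prop. 10.26] -/
theorem oneParameterAbelianSchemeVHCGerm_of_abelianSchemeVHCPrimitiveEven (h : AbelianSchemeVHCPrimitiveEven) :
    OneParameterAbelianSchemeVHCGerm :=
  oneParameterAbelianSchemeVHCGerm_of_upTo_of_primitiveEvenFrom abelianSchemeVHC_upTo_three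
    (abelianSchemeVHCPrimitiveEvenFrom_of_abelianSchemeVHCPrimitiveEven 4 h)

/-- **The fibrewise-primitive form (any relative dimension) gives the germ form — FACT-FREE.** [cite: CharlesSchnell2014Notes, Conj. 11.3.1]
[cite: KerrPearlstein2011, §3.1] -/
theorem oneParameterAbelianSchemeVHCGerm_of_abelianSchemeVHCPrimitive (h : AbelianSchemeVHCPrimitive) :
    OneParameterAbelianSchemeVHCGerm :=
  oneParameterAbelianSchemeVHCGerm_of_abelianSchemeVHCPrimitiveEven (abelianSchemeVHCPrimitiveEven_of_abelianSchemeVHCPrimitive h)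

/-! ## §3 The binder: row b02 IS its fibrewise-primitive deep-middle form on even relative dimension, modulo the print residual -/

/-- **`HCUpToDim g ⟹ (row b02 ⟺ its even fibrewise-primitive form from relative dimension `g + 1` on)`**, modulo the curve print
residual N97 (`OneParameterAbelianSchemeQuasiProjective`, used in `←`): the class target closes the slices `n ≤ g` (rungs
`abelianSchemeVHC_upTo_of_hcUpToDim`), the shadow, the padding and the global first Lefschetz step close everything else.
[cite: CharlesSchnell2014Notes, Cor. 11.3.6 and Prop. 11.3.11 (proof)] [cite: KerrPearlstein2011, §3.1] [cite: GortzWedhorn2023, Thm. 27.291] -/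
theorem abelianSchemeVHC_iff_primitiveEvenFrom_of_hcUpToDim (hqp : OneParameterAbelianSchemeQuasiProjective) {g : ℕ}
    (h : HCUpToDim g) : AbelianSchemeVHC ↔ AbelianSchemeVHCPrimitiveEvenFrom[g + 1] :=
  ⟨abelianSchemeVHCPrimitiveEvenFrom_of_abelianSchemeVHC (g + 1), fun h₂ ↦
    (abelianSchemeVHC_iff_germ_of_oneParameterAbelianSchemeQuasiProjective hqp).2
      (oneParameterAbelianSchemeVHCGerm_of_upTo_of_primitiveEvenFrom (abelianSchemeVHC_upTo_of_hcUpToDim h) h₂)⟩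

/-- **EXACTNESS modulo the curve print residual: row b02 `AbelianSchemeVHC` ⟺ the variational Hodge conjecture for fibrewise
LEFSCHETZ-PRIMITIVE classes of codimension `2 ≤ p ≤ n/2` on abelian schemes of EVEN relative dimension `n ≥ 4`** (first cell:
abelian fourfold families, `p = 2`, `W| ∈ P⁴ = ker (L : H⁴ → H⁶)`). Granted only N97 (in `←`).
[cite: CharlesSchnell2014Notes, Conj. 11.3.1 and Prop. 11.3.11 (proof)] [cite: VoisinHodgeI2002, Def. 6.24, Thm. 6.25, Cor. 6.26]
[cite: KerrPearlstein2011, §3.1] [cite: GortzWedhorn2023, Thm. 27.291] -/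
theorem abelianSchemeVHC_iff_primitiveEvenFrom_four_of_oneParameterAbelianSchemeQuasiProjective
    (hqp : OneParameterAbelianSchemeQuasiProjective) : AbelianSchemeVHC ↔ AbelianSchemeVHCPrimitiveEvenFrom[4] :=
  ⟨abelianSchemeVHCPrimitiveEvenFrom_of_abelianSchemeVHC 4, fun h₂ ↦
    (abelianSchemeVHC_iff_germ_of_oneParameterAbelianSchemeQuasiProjective hqp).2
      (oneParameterAbelianSchemeVHCGerm_of_upTo_of_primitiveEvenFrom abelianSchemeVHC_upTo_three h₂)⟩

/-- **The same modulo Raynaud's theorem as booked (`raynaud1970_abelianScheme_section_projective`, c20): row b02 ⟺ its even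
fibrewise-primitive form from relative dimension `4` on.** CONDITIONAL on the named fact (used in `←` only).
[cite: GortzWedhorn2023, §(27.53) Thm. 27.291] [cite: LaurentSchroer2023, §4 Prop. 4.3] [cite: KerrPearlstein2011, §3.1] -/
theorem abelianSchemeVHC_iff_primitiveEvenFrom_four_of_raynaud1970 (hR : raynaud1970_abelianScheme_section_projective) :
    AbelianSchemeVHC ↔ AbelianSchemeVHCPrimitiveEvenFrom[4] :=
  abelianSchemeVHC_iff_primitiveEvenFrom_four_of_oneParameterAbelianSchemeQuasiProjective
    (oneParameterAbelianSchemeQuasiProjective_of_raynaud1970 hR)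

/-- **Row b02 ⟺ `AbelianSchemeVHCPrimitiveEven`** modulo Raynaud (c20, in `←`). [cite: GortzWedhorn2023, Thm. 27.291]
[cite: KerrPearlstein2011, §3.1] [cite: VoisinHodgeI2002, Cor. 6.26] -/
theorem abelianSchemeVHC_iff_primitiveEven_of_raynaud1970 (hR : raynaud1970_abelianScheme_section_projective) :
    AbelianSchemeVHC ↔ AbelianSchemeVHCPrimitiveEven :=
  ⟨fun h ↦ abelianSchemeVHCPrimitiveEven_of_abelianSchemeVHCPrimitive (abelianSchemeVHCPrimitive_of_abelianSchemeVHC h),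
    fun h ↦ (abelianSchemeVHC_iff_primitiveEvenFrom_four_of_raynaud1970 hR).2
      (abelianSchemeVHCPrimitiveEvenFrom_of_abelianSchemeVHCPrimitiveEven 4 h)⟩

/-- **Row b02 ⟺ `AbelianSchemeVHCPrimitive`** (any relative dimension) modulo Raynaud (c20, in `←`).
[cite: GortzWedhorn2023, Thm. 27.291] [cite: KerrPearlstein2011, §3.1] [cite: VoisinHodgeI2002, Cor. 6.26] -/
theorem abelianSchemeVHC_iff_primitive_of_raynaud1970 (hR : raynaud1970_abelianScheme_section_projective) :
    AbelianSchemeVHC ↔ AbelianSchemeVHCPrimitive :=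
  ⟨abelianSchemeVHCPrimitive_of_abelianSchemeVHC, fun h ↦ (abelianSchemeVHC_iff_primitiveEven_of_raynaud1970 hR).2
    (abelianSchemeVHCPrimitiveEven_of_abelianSchemeVHCPrimitive h)⟩

/-- **Modulo Raynaud (c20), Markman's Weil-fourfold claim (c28) and Moonen–Zarhin (c9), row b02 IS its even fibrewise-primitive
form from relative dimension `6` on**: first cells `(6, 2)` and `(6, 3)`, fibrewise primitive. All three inputs displayed as
hypotheses. [cite: MoonenZarhin1999LowDim, Thms. 0.1–0.2] [cite: Markman2025SecantWeil, Cor. 1.6.1 (unrefereed)]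
[cite: GortzWedhorn2023, Thm. 27.291] [cite: KerrPearlstein2011, §3.1] -/
theorem abelianSchemeVHC_iff_primitiveEvenFrom_six_of_weilClassesFourfolds_of_moonenZarhin_of_raynaud1970
    (hR : raynaud1970_abelianScheme_section_projective) (hW : Markman2025_weilClasses_algebraic_abelianFourfold)
    (hMZ : MoonenZarhin1999_hodgeClasses_abelian_dim_le_five_of_weilClassesFourfolds) :
    AbelianSchemeVHC ↔ AbelianSchemeVHCPrimitiveEvenFrom[6] :=
  abelianSchemeVHC_iff_primitiveEvenFrom_of_hcUpToDim (oneParameterAbelianSchemeQuasiProjective_of_raynaud1970 hR)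
    (hcUpToDim_five_of_weilClassesFourfolds_of_moonenZarhin hW hMZ)

/-- The same granted the support item `HodgeAbelianDimLeFive` of route `SevenfoldWeilCensus` (stmt-HodgeConjecture-18723) by name,
modulo Raynaud (c20). [cite: Markman2025SurveySecant, Cor. 1.3 (unrefereed)] [cite: GortzWedhorn2023, Thm. 27.291] -/
theorem abelianSchemeVHC_iff_primitiveEvenFrom_six_of_hodgeAbelianDimLeFive_of_raynaud1970
    (hR : raynaud1970_abelianScheme_section_projective) (h₅ : Theses.SevenfoldWeilCensus.HodgeAbelianDimLeFive) :
    AbelianSchemeVHC ↔ AbelianSchemeVHCPrimitiveEvenFrom[6] :=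
  abelianSchemeVHC_iff_primitiveEvenFrom_of_hcUpToDim (oneParameterAbelianSchemeQuasiProjective_of_raynaud1970 hR)
    (hcUpToDim_five_iff_hodgeAbelianDimLeFive.mpr h₅)

/-- **`HC_AV` ⟺ the even fibrewise-primitive form of row b02 from relative dimension `4` on**, modulo André 1996 #21/#22 (c11,
c12) and Raynaud (c20): deform IV's (E₂′) `Deform.HC_AV_iff_abelianSchemeVHC_of_andre1996` composed with §3. No `HC_CM`.
[cite: Andre1996Motifs, §6.3 Lemmes 6.3.1–6.3.3] [cite: KerrPearlstein2011, §3.1] [cite: Lieberman1968, main theorem] -/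
theorem hc_av_iff_abelianSchemeVHCPrimitiveEvenFrom_four_of_andre1996_of_raynaud1970
    (h₂₁ : andre1996_cmAnchoredPencil) (h₂₂ : andre1996_cmHodgeClasses_algebraicallyAnchoredPencils)
    (hR : raynaud1970_abelianScheme_section_projective) :
    Theses.PadicSemiregularLift.HodgeAbelianVarieties ↔ AbelianSchemeVHCPrimitiveEvenFrom[4] :=
  (Deform.HC_AV_iff_abelianSchemeVHC_of_andre1996 h₂₁ h₂₂).trans
    (abelianSchemeVHC_iff_primitiveEvenFrom_four_of_raynaud1970 hR)

/-! ## Audit: what the kernel now says about row b02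

`AbelianSchemeVHCPrimitiveEvenFrom[g] →` row b02 on quasi-projective carriers of relative dimension `≥ g`, `AbelianSchemeVHCPrimitive[Even] →
OneParameterAbelianSchemeVHCGerm` FACT-FREE (§2); `AbelianSchemeVHC ↔ AbelianSchemeVHCPrimitive ↔ AbelianSchemeVHCPrimitiveEven ↔
AbelianSchemeVHCPrimitiveEvenFrom[4]` modulo N97 / c20 displayed as hypotheses (§3); `HC_CM` does not occur; route items and the facts
c9, c11, c12, c28 enter by name as hypotheses only. Closures below are the three standard axioms. -/

#print axioms Summit.HodgeConjecture.HodgeConjecture.Ring2.Binders.map_fiberι_mem_algebraicClasses_of_abelianSchemeVHCPrimitiveEvenFrom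
#print axioms Summit.HodgeConjecture.HodgeConjecture.Ring2.Binders.oneParameterAbelianSchemeVHCGerm_of_abelianSchemeVHCPrimitive
#print axioms Summit.HodgeConjecture.HodgeConjecture.Ring2.Binders.abelianSchemeVHC_iff_primitiveEvenFrom_four_of_raynaud1970
#print axioms Summit.HodgeConjecture.HodgeConjecture.Ring2.Binders.hc_av_iff_abelianSchemeVHCPrimitiveEvenFrom_four_of_andre1996_of_raynaud1970

end Summit.HodgeConjecture.HodgeConjecture.Ring2.Binders

end
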